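import Mathlib
import Summits.Ventures.PercRepro2.CoinChainXACellFacts

/-!
# The ideal's two parts and their facts: `aD = Σ_I νd` is bounded by the `d/c` ratio of every coin-entered cell, and the
gate ratio on the ideal `aG = Σ_I νd'` is below the gate ratio on every cell
(blind cell PercRepro2, night-2 g34; proofs/NIGHT2-DARC.md §74.9)

Every cell fact of the chain's families so far relaxed a meet falling into the ideal `I` by the ideal's `c`-mass `a`.
The refined family (§74.9 — numerically the first complete one for the general gate) keeps the ideal's `d`-mass
`aD = Σ_I νd` and gate mass `aG = Σ_I νd'` as parts, with the two facts of this file: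

* `cg_fact_ratioI`: `(Σ_I νd)·(Σ_T νc·w) ≤ (Σ_I νc)·(Σ_T νd·w)` for every coin-entered cell `T` (a marker weight `w`,
  unchanged by adding an ideal cluster) — the four-functions instance `(d on I, c on T) → (c on I, d on T)`, pointwise
  `hcd (t, s)`; in the cells: `aD·(K_T + U_T) ≤ a·U_T`.
* `cg_fact_aGmono`: `(Σ_I νd')·(Σ_P νd·w) ≤ (Σ_I νd)·(Σ_P νd'·w)` for every region `P` closed under joining an ideal
  cluster (the coin-entered and the `m`-cluster cells) — the instance `(d' on I, d on P) → (d on I, d' on P)`, pointwise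
  `hdd' (t, s)`; in the cells: `aG·d_T ≤ aD·g_T`.
-/

namespace Summit.Ventures.PercRepro2.Coin

open Classical

section IdealFacts

variable {V : Type*} [DecidableEq V] {R : Type*} [Field R] [LinearOrder R] [IsStrictOrderedRing R]

/-- **The ideal's `d`-mass against a coin-entered cell**: `(Σ_I νd)·(Σ_{D'} νc·w) ≤ (Σ_I νc)·(Σ_{D'} νd·w)` for a
nonnegative weight `w` with `w (s ∪ t) = w t` whenever `s` is an ideal cluster. -/
theorem cg_fact_ratioI (U : Finset V) (m : V) (ent' : Finset V) (ν c d : Finset V → R)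
    (hν0 : ∀ W, 0 ≤ ν W) (hν : ∀ s ⊆ U, ∀ t ⊆ U, ν s * ν t ≤ ν (s ∩ t) * ν (s ∪ t))
    (hc0 : ∀ W, 0 ≤ c W) (hd0 : ∀ W, 0 ≤ d W)
    (hcd : ∀ s t, c s * d t ≤ c (s ∩ t) * d (s ∪ t))
    (w : Finset V → R) (hw0 : ∀ W, 0 ≤ w W)
    (hwI : ∀ s t, (¬ ∃ r ∈ ({m} : Finset V) ∪ ent', r ∈ s) → w (s ∪ t) = w t) :
    (∑ W ∈ U.powerset.filter (fun W => ¬ ∃ r ∈ ({m} : Finset V) ∪ ent', r ∈ W), ν W * d W)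
      * (∑ W ∈ U.powerset.filter (fun W => (¬ ∃ r ∈ ({m} : Finset V), r ∈ W) ∧ ∃ r ∈ ent', r ∈ W), ν W * c W * w W) ≤
    (∑ W ∈ U.powerset.filter (fun W => ¬ ∃ r ∈ ({m} : Finset V) ∪ ent', r ∈ W), ν W * c W)
      * (∑ W ∈ U.powerset.filter (fun W => (¬ ∃ r ∈ ({m} : Finset V), r ∈ W) ∧ ∃ r ∈ ent', r ∈ W), ν W * d W * w W) := by
  have key := cell_fact U ν d (fun W => c W * w W) c (fun W => d W * w W) (fun _ => 1) (fun _ => 1) (fun _ => 1) (fun _ => 1)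
    (fun W => ¬ ∃ r ∈ ({m} : Finset V) ∪ ent', r ∈ W) (fun W => (¬ ∃ r ∈ ({m} : Finset V), r ∈ W) ∧ ∃ r ∈ ent', r ∈ W)
    (fun W => ¬ ∃ r ∈ ({m} : Finset V) ∪ ent', r ∈ W) (fun W => (¬ ∃ r ∈ ({m} : Finset V), r ∈ W) ∧ ∃ r ∈ ent', r ∈ W)
    hν0 hν hd0 (fun W => mul_nonneg (hc0 W) (hw0 W)) hc0 (fun W => mul_nonneg (hd0 W) (hw0 W))
    (fun _ => zero_le_one) (fun _ => zero_le_one) (fun _ => zero_le_one) (fun _ => zero_le_one)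
    (by
      intro s t hs ht
      refine ⟨fun ⟨r, hr, hrst⟩ => hs ⟨r, hr, (Finset.mem_inter.1 hrst).1⟩, ?_, ?_⟩
      · rintro ⟨r, hr, hrst⟩
        rcases Finset.mem_union.1 hrst with h | h
        · exact hs ⟨r, Finset.mem_union.2 (Or.inl hr), h⟩
        · exact ht.1 ⟨r, hr, h⟩
      · obtain ⟨r, hr, hrt⟩ := ht.2
        exact ⟨r, hr, Finset.mem_union.2 (Or.inr hrt)⟩)
    (by
      intro s t hs _
      rw [hwI s t hs]
      calc d s * (c t * w t) = (c t * d s) * w t := by ring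
        _ ≤ (c (t ∩ s) * d (t ∪ s)) * w t := mul_le_mul_of_nonneg_right (hcd t s) (hw0 t)
        _ = c (s ∩ t) * (d (s ∪ t) * w t) := by rw [Finset.inter_comm, Finset.union_comm]; ring)
    (fun _ _ => by norm_num)
  simp only [mul_one, ← mul_assoc] at key
  exact key

/-- **The gate ratio on the ideal is below the gate ratio on every cell**: for a region `P` closed under joining an ideal
cluster, `(Σ_I νd')·(Σ_P νd·w) ≤ (Σ_I νd)·(Σ_P νd'·w)`. -/
theorem cg_fact_aGmono (U : Finset V) (m : V) (ent' : Finset V) (ν d d' : Finset V → R)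
    (hν0 : ∀ W, 0 ≤ ν W) (hν : ∀ s ⊆ U, ∀ t ⊆ U, ν s * ν t ≤ ν (s ∩ t) * ν (s ∪ t))
    (hd0 : ∀ W, 0 ≤ d W) (hd'0 : ∀ W, 0 ≤ d' W)
    (hdd' : ∀ s t, d s * d' t ≤ d (s ∩ t) * d' (s ∪ t))
    (P : Finset V → Prop) [DecidablePred P]
    (hP : ∀ s t, (¬ ∃ r ∈ ({m} : Finset V) ∪ ent', r ∈ s) → P t → P (s ∪ t))
    (w : Finset V → R) (hw0 : ∀ W, 0 ≤ w W)
    (hwI : ∀ s t, (¬ ∃ r ∈ ({m} : Finset V) ∪ ent', r ∈ s) → w (s ∪ t) = w t) :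
    (∑ W ∈ U.powerset.filter (fun W => ¬ ∃ r ∈ ({m} : Finset V) ∪ ent', r ∈ W), ν W * d' W)
      * (∑ W ∈ U.powerset.filter P, ν W * d W * w W) ≤
    (∑ W ∈ U.powerset.filter (fun W => ¬ ∃ r ∈ ({m} : Finset V) ∪ ent', r ∈ W), ν W * d W)
      * (∑ W ∈ U.powerset.filter P, ν W * d' W * w W) := by
  have key := cell_fact U ν d' (fun W => d W * w W) d (fun W => d' W * w W) (fun _ => 1) (fun _ => 1) (fun _ => 1) (fun _ => 1)
    (fun W => ¬ ∃ r ∈ ({m} : Finset V) ∪ ent', r ∈ W) P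
    (fun W => ¬ ∃ r ∈ ({m} : Finset V) ∪ ent', r ∈ W) P
    hν0 hν hd'0 (fun W => mul_nonneg (hd0 W) (hw0 W)) hd0 (fun W => mul_nonneg (hd'0 W) (hw0 W))
    (fun _ => zero_le_one) (fun _ => zero_le_one) (fun _ => zero_le_one) (fun _ => zero_le_one)
    (by
      intro s t hs ht
      exact ⟨fun ⟨r, hr, hrst⟩ => hs ⟨r, hr, (Finset.mem_inter.1 hrst).1⟩, hP s t hs ht⟩)
    (by
      intro s t hs _
      rw [hwI s t hs]
      calc d' s * (d t * w t) = (d t * d' s) * w t := by ring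
        _ ≤ (d (t ∩ s) * d' (t ∪ s)) * w t := mul_le_mul_of_nonneg_right (hdd' t s) (hw0 t)
        _ = d (s ∩ t) * (d' (s ∪ t) * w t) := by rw [Finset.inter_comm, Finset.union_comm]; ring)
    (fun _ _ => by norm_num)
  simp only [mul_one, ← mul_assoc] at key
  exact key

end IdealFacts

end Summit.Ventures.PercRepro2.Coin
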